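import Literature.Geometry.Kaehler.ComplexTorusWeilTranscendence
import HarnessLib

/-!
# Rational subspaces of `Γ_ℝ`, base change `ℚ → ℝ`, and Part B of `End_ℚ(X) = ℚ(i)` for the Weil torus

Third file of the simplicity proof for the explicit complex torus of Weil type
(`ComplexTorusWeilStructure.lean`, `ComplexTorusWeilTranscendence.lean`, `ComplexTorusWeilSimple.lean`;
C. Voisin, IMRN 2002 no. 20, §3 Prop. 3 (ii)).

* Base change from `ℚ` to `ℝ` for subspaces of `Γ_ℝ = ℝ⁸` spanned by rational vectors (a rational
  left inverse stays a left inverse over `ℝ`): `mulVec_real_eq_zero_imp`, `linearIndependent_ratVec`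
  (`ℚ`-independent rational vectors are `ℝ`-independent), `finrank_span_ratVec`
  (`dim_ℝ span_ℝ = dim_ℚ span_ℚ`), `exists_span_ratVec_eq_inf` (intersections of rational subspaces
  are rational), `exists_rat_mulVec_eq_zero` (a rational matrix whose rows span a proper subspace of
  `ℝ⁸` kills a non-zero RATIONAL vector);
* `finrank_eq_two_mul_finrank_cx` and **`projQ_mem_cx`**: for an `A`-stable real subspace `U`,
  `dim_ℝ U = 2 dim_ℂ ζ(U)`, and `I_t`-stability of `U` is `π_Q`-stability of `ζ(U)`;
* **`eq_zero_of_anticommute`** (Part B of `End_ℚ(X) = ℚ(i)`): a real-linear map of `Γ_ℝ` with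
  rational matrix which anticommutes with `A` and commutes with `I_t` vanishes — its `ℂ`-linear
  avatar `M''` maps `N_Q` into `N_P` (`antiMap_mem_NP`), so (T4) applies.

No definition and no named fact is introduced.

## References

* C. Voisin, *A counterexample to the Hodge conjecture extended to Kähler varieties*, IMRN 2002
  no. 20, 1057–1075 (arXiv:math/0112247), §3 p. 5 (the torus of Weil type, `W = W_i ⊕ W_{-i}`,
  `W ∩ Γ_ℝ = {0}`) and Prop. 3 (ii) ("`X` is simple" for the general member).
  [Voisin2002KaehlerCounterexample]
* Ch. Birkenhake, H. Lange, *Complex Abelian Varieties* (1992), §1.1–1.2 (period matrices, complex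
  subtori and rational complex subspaces). [LangeBirkenhake1992]
-/

noncomputable section

open scoped ComplexConjugate Matrix
open Polynomial Module

namespace Literature.Geometry.Kaehler

namespace Weil

/-! ### Rational vectors in `ℝ⁸` and base change from `ℚ` to `ℝ` -/

/-- **Base change of injectivity**: a rational matrix with trivial rational kernel has trivial real
kernel (a rational left inverse stays a left inverse over `ℝ`). [folklore] -/
theorem mulVec_real_eq_zero_imp {m' n' : Type*} [Fintype m'] [DecidableEq m'] [Fintype n']
    [DecidableEq n'] (N : Matrix m' n' ℚ) (hN : ∀ q, N *ᵥ q = 0 → q = 0) (x : n' → ℝ)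
    (hx : N.map (Rat.castHom ℝ) *ᵥ x = 0) : x = 0 := by
  have hker : LinearMap.ker N.mulVecLin = ⊥ :=
    LinearMap.ker_eq_bot'.2 fun q hq ↦ hN q hq
  obtain ⟨G, hG⟩ := LinearMap.exists_leftInverse_of_injective N.mulVecLin hker
  set Gm := LinearMap.toMatrix' G with hGm
  have hGN : Gm * N = 1 := by
    apply Matrix.toLin'.injective
    rw [Matrix.toLin'_mul, hGm, Matrix.toLin'_toMatrix', Matrix.toLin'_one, Matrix.toLin'_apply']
    exact hG
  have h1 : Gm.map (Rat.castHom ℝ) * N.map (Rat.castHom ℝ) = 1 := by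
    rw [← Matrix.map_mul, hGN, Matrix.map_one _ (map_zero _) (map_one _)]
  calc x = (1 : Matrix n' n' ℝ) *ᵥ x := (Matrix.one_mulVec x).symm
    _ = Gm.map (Rat.castHom ℝ) *ᵥ (N.map (Rat.castHom ℝ) *ᵥ x) := by rw [← h1, Matrix.mulVec_mulVec]
    _ = 0 := by rw [hx, Matrix.mulVec_zero]

/-- **Linear independence over `ℚ` implies linear independence over `ℝ`** for rational vectors.
[folklore] -/
theorem linearIndependent_ratVec {ι : Type*} [Fintype ι] (b : ι → Fin 8 → ℚ)
    (hb : LinearIndependent ℚ b) : LinearIndependent ℝ (fun i ↦ ratVec (b i)) := by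
  classical
  rw [Fintype.linearIndependent_iff] at hb ⊢
  intro g hg
  set N : Matrix (Fin 8) ι ℚ := Matrix.of fun j i ↦ b i j with hN
  have hmul : ∀ c : ι → ℚ, N *ᵥ c = ∑ i, c i • b i := fun c ↦ by
    funext j; simp [hN, Matrix.mulVec, dotProduct, Finset.sum_apply, mul_comm]
  have hmulR : N.map (Rat.castHom ℝ) *ᵥ g = ∑ i, g i • ratVec (b i) := by
    funext j; simp [hN, Matrix.mulVec, dotProduct, Finset.sum_apply, mul_comm]
  have hNinj : ∀ q, N *ᵥ q = 0 → q = 0 := fun q hq ↦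
    funext fun i ↦ hb q (by rw [← hmul]; exact hq) i
  have := mulVec_real_eq_zero_imp N hNinj g (by rw [hmulR]; exact hg)
  exact fun i ↦ congrFun this i

/-- A rational linear combination stays in the real span. [folklore] -/
theorem ratVec_mem_span_of_mem_span {ι : Type*} (b : ι → Fin 8 → ℚ) {q : Fin 8 → ℚ}
    (hq : q ∈ Submodule.span ℚ (Set.range b)) :
    ratVec q ∈ Submodule.span ℝ (Set.range fun i ↦ ratVec (b i)) := by
  have h1 : ratVecₗ q ∈ (Submodule.span ℚ (Set.range b)).map ratVecₗ := Submodule.mem_map_of_mem hq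
  rw [Submodule.map_span] at h1
  have h2 : ratVecₗ '' Set.range b = Set.range fun i ↦ ratVec (b i) := by
    ext x; simp [Set.mem_image, Set.mem_range]
  rw [h2] at h1
  exact Submodule.span_le_restrictScalars ℚ ℝ _ h1

/-- **Base change of dimension**: the real span of finitely many rational vectors has the same
dimension as their rational span. [folklore] -/
theorem finrank_span_ratVec {ι : Type*} [Fintype ι] (b : ι → Fin 8 → ℚ) :
    finrank ℝ (Submodule.span ℝ (Set.range fun i ↦ ratVec (b i))) =
      finrank ℚ (Submodule.span ℚ (Set.range b)) := by
  classical
  obtain ⟨κ, a, -, hspan, hli⟩ := exists_linearIndependent' (K := ℚ) b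
  haveI : Finite κ := hli.finite
  haveI : Fintype κ := Fintype.ofFinite κ
  have hR : Submodule.span ℝ (Set.range fun i ↦ ratVec (b i)) =
      Submodule.span ℝ (Set.range fun k ↦ ratVec (b (a k))) := by
    apply le_antisymm
    · rw [Submodule.span_le]
      rintro _ ⟨i, rfl⟩
      have hi : b i ∈ Submodule.span ℚ (Set.range (b ∘ a)) := by
        rw [hspan]; exact Submodule.subset_span ⟨i, rfl⟩
      exact ratVec_mem_span_of_mem_span (b ∘ a) hi
    · rw [Submodule.span_le]
      rintro _ ⟨k, rfl⟩
      exact Submodule.subset_span ⟨a k, rfl⟩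
  rw [hR, ← hspan, finrank_span_eq_card hli]
  exact finrank_span_eq_card (linearIndependent_ratVec (b ∘ a) hli)

/-- The real span of a rational family, with both rational families put together, is the sup. [folklore] -/
theorem span_ratVec_sum {ι ι' : Type*} (b : ι → Fin 8 → ℚ) (b' : ι' → Fin 8 → ℚ) :
    Submodule.span ℝ (Set.range fun i ↦ ratVec (Sum.elim b b' i)) =
      Submodule.span ℝ (Set.range fun i ↦ ratVec (b i)) ⊔
        Submodule.span ℝ (Set.range fun i ↦ ratVec (b' i)) := by
  rw [← Submodule.span_union]
  congr 1
  ext x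
  simp only [Set.mem_range, Set.mem_union, Sum.exists, Sum.elim_inl, Sum.elim_inr]

/-- The rational span of two families put together is the sup of the spans. [folklore] -/
theorem span_sum {ι ι' : Type*} (b : ι → Fin 8 → ℚ) (b' : ι' → Fin 8 → ℚ) :
    Submodule.span ℚ (Set.range (Sum.elim b b')) =
      Submodule.span ℚ (Set.range b) ⊔ Submodule.span ℚ (Set.range b') := by
  rw [← Submodule.span_union, Set.Sum.elim_range]

/-- **Intersections of rational subspaces are rational**: the intersection of the real spans of
two finite rational families is the real span of a finite rational family (dimension count after
base change). [folklore] -/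
theorem exists_span_ratVec_eq_inf {ι ι' : Type*} [Fintype ι] [Fintype ι'] (b : ι → Fin 8 → ℚ)
    (b' : ι' → Fin 8 → ℚ) :
    ∃ (k : ℕ) (r : Fin k → Fin 8 → ℚ), Submodule.span ℝ (Set.range fun i ↦ ratVec (r i)) =
      Submodule.span ℝ (Set.range fun i ↦ ratVec (b i)) ⊓
        Submodule.span ℝ (Set.range fun i ↦ ratVec (b' i)) := by
  classical
  let W : Submodule ℚ (Fin 8 → ℚ) := Submodule.span ℚ (Set.range b) ⊓ Submodule.span ℚ (Set.range b')
  let bW := Module.finBasis ℚ W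
  let r : Fin (finrank ℚ W) → Fin 8 → ℚ := fun i ↦ (bW i : Fin 8 → ℚ)
  have hrW : Submodule.span ℚ (Set.range r) = W := by
    have h1 : Set.range r = W.subtype '' Set.range bW := by
      rw [← Set.range_comp]; rfl
    rw [h1, ← Submodule.map_span, bW.span_eq, Submodule.map_top, Submodule.range_subtype]
  refine ⟨finrank ℚ W, r, ?_⟩
  apply Submodule.eq_of_le_of_finrank_eq
  · rw [Submodule.span_le]
    rintro _ ⟨i, rfl⟩
    have hri : r i ∈ W := by rw [← hrW]; exact Submodule.subset_span ⟨i, rfl⟩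
    exact ⟨ratVec_mem_span_of_mem_span b hri.1, ratVec_mem_span_of_mem_span b' hri.2⟩
  · -- dimension count
    have hd := Submodule.finrank_sup_add_finrank_inf_eq
      (Submodule.span ℝ (Set.range fun i ↦ ratVec (b i)))
      (Submodule.span ℝ (Set.range fun i ↦ ratVec (b' i)))
    have hdq := Submodule.finrank_sup_add_finrank_inf_eq
      (Submodule.span ℚ (Set.range b)) (Submodule.span ℚ (Set.range b'))
    rw [← span_ratVec_sum, finrank_span_ratVec, finrank_span_ratVec, finrank_span_ratVec,
      span_sum] at hd
    rw [finrank_span_ratVec, hrW]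
    change finrank ℚ ↥(Submodule.span ℚ (Set.range b) ⊓ Submodule.span ℚ (Set.range b')) = _
    omega

/-- **Rational kernel vectors**: if the rows of a rational matrix span (over `ℝ`) a subspace of
dimension `< 8`, the matrix kills a non-zero RATIONAL vector. [folklore] -/
theorem exists_rat_mulVec_eq_zero {m' : Type*} [Fintype m'] [DecidableEq m'] (N : Matrix m' (Fin 8) ℚ)
    (hlt : finrank ℝ (Submodule.span ℝ (Set.range fun i ↦ ratVec (N i))) < 8) :
    ∃ q : Fin 8 → ℚ, q ≠ 0 ∧ N *ᵥ q = 0 := by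
  by_contra hcon
  simp only [not_exists, not_and] at hcon
  have hN : ∀ q, N *ᵥ q = 0 → q = 0 := fun q hq ↦ by
    by_contra h; exact hcon q h hq
  set Nr := N.map (Rat.castHom ℝ) with hNr
  have hker : LinearMap.ker Nr.mulVecLin = ⊥ :=
    LinearMap.ker_eq_bot'.2 fun x hx ↦ mulVec_real_eq_zero_imp N hN x hx
  have hrn := LinearMap.finrank_range_add_finrank_ker Nr.mulVecLin
  rw [hker, finrank_bot, add_zero] at hrn
  have hrank : Nr.rank = finrank ℝ (Submodule.span ℝ (Set.range fun i ↦ ratVec (N i))) := by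
    rw [Matrix.rank_eq_finrank_span_row]
    rfl
  have h8 : finrank ℝ (Fin 8 → ℝ) = 8 := by simp
  rw [Matrix.rank] at hrank
  omega

/-! ### `A`-stable real subspaces of `Γ_ℝ` as complex subspaces of `ℂ⁴_ζ` -/

/-- `dim_ℝ U = 2 dim_ℂ ζ(U)`. [folklore] -/
theorem finrank_eq_two_mul_finrank_cx (U : Submodule ℝ (Fin 8 → ℝ)) (hA : ∀ x ∈ U, rotLin x ∈ U) :
    finrank ℝ U = 2 * finrank ℂ (cx U hA) := by
  let f : U →ₗ[ℝ] (cx U hA).restrictScalars ℝ :=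
    { toFun := fun x ↦ ⟨zetaVec x, x, x.2, rfl⟩
      map_add' := fun x y ↦ Subtype.ext (map_add zetaEquiv (x : Fin 8 → ℝ) (y : Fin 8 → ℝ))
      map_smul' := fun r x ↦ Subtype.ext (map_smul zetaEquiv r (x : Fin 8 → ℝ)) }
  have hf : Function.Bijective f := by
    constructor
    · intro x y hxy
      exact Subtype.ext (zetaEquiv.injective (congrArg Subtype.val hxy))
    · rintro ⟨_, x, hx, rfl⟩
      exact ⟨⟨x, hx⟩, rfl⟩
  have e := LinearEquiv.ofBijective f hf
  rw [e.finrank_eq]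
  change finrank ℝ (cx U hA) = _
  rw [← Module.finrank_mul_finrank ℝ ℂ (cx U hA), Complex.finrank_real_complex]

/-- **`I_t`-stability becomes `π_Q`-stability**: if `U` is `A`-stable and `I_t`-stable then `ζ(U)`
is stable under the projection `π_Q` (since `I_t = i(π_Q - π_P)` and `i` preserves `ζ(U)`).
[cite: Voisin2002KaehlerCounterexample, §3 Prop. 3 (ii)] -/
theorem projQ_mem_cx {U : Submodule ℝ (Fin 8 → ℝ)} {hA : ∀ x ∈ U, rotLin x ∈ U}
    (hcs : ∀ x ∈ U, cs x ∈ U) {u : Fin 4 → ℂ} (hu : u ∈ cx U hA) : projQ u ∈ cx U hA := by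
  obtain ⟨x, hx, rfl⟩ := hu
  have h1 : zetaVec (cs x) ∈ cx U hA := zetaVec_mem_cx (hcs x hx)
  rw [zetaVec_cs] at h1
  have h2 : Complex.I • zetaVec x ∈ cx U hA := (cx U hA).smul_mem _ (zetaVec_mem_cx hx)
  have h3 : Complex.I • projQ (zetaVec x) - Complex.I • projP (zetaVec x) + Complex.I • zetaVec x =
      (2 * Complex.I) • projQ (zetaVec x) := by
    conv_lhs => rw [show Complex.I • zetaVec x =
      Complex.I • (projQ (zetaVec x) + projP (zetaVec x)) by rw [projQ_add_projP]]
    rw [smul_add, mul_smul, two_smul]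
    abel
  have h4 := (cx U hA).add_mem h1 h2
  rw [h3] at h4
  have h5 := (cx U hA).smul_mem (2 * Complex.I)⁻¹ h4
  rwa [smul_smul, inv_mul_cancel₀ (by simp : (2 * Complex.I) ≠ 0), one_smul] at h5

/-! ### Rational maps anticommuting with `A` and commuting with `I_t` vanish -/

section AntiLinear

variable (L : (Fin 8 → ℝ) →ₗ[ℝ] (Fin 8 → ℝ)) (hanti : ∀ x, L (rotLin x) = -rotLin (L x))

/-- If moreover `L` commutes with `I_t`, then `M''` maps `N_Q` into `N_P` (it anticommutes with
`π_Q - π_P`). [cite: Voisin2002KaehlerCounterexample, §3 Prop. 3 (ii)] -/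
theorem antiMap_mem_NP (hcs : ∀ x, L (cs x) = cs (L x)) {u : Fin 4 → ℂ} (hu : u ∈ NQ) :
    antiMap L hanti u ∈ NP := by
  have hsu : star u ∈ NQ := by rw [mem_NQ, Qmap_star, mem_NQ.1 hu, star_zero]
  set x := zetaEquiv.symm (star u) with hx
  have hzx : zetaVec x = star u := by rw [hx, ← zetaEquiv_apply, LinearEquiv.apply_symm_apply]
  have key := congrArg zetaVec (hcs x)
  rw [zetaVec_L L hanti, zetaVec_cs, zetaVec_cs, hzx, projQ_eq_self hsu, projP_eq_zero hsu,
    smul_zero, sub_zero, star_smul, star_star, Complex.star_def, Complex.conj_I, map_smul,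
    zetaVec_L L hanti, hzx, star_star] at key
  set w := antiMap L hanti u with hw
  -- key : -I • w = I • π_Q w - I • π_P w
  have hdec := projQ_add_projP w
  have h2 : (2 * Complex.I) • projQ w = 0 := by
    have e1 : Complex.I • w = Complex.I • projQ w + Complex.I • projP w := by
      conv_lhs => rw [← hdec]
      rw [smul_add]
    rw [mul_smul, two_smul]
    have : -Complex.I • w + Complex.I • w = 0 := by rw [neg_smul, neg_add_cancel]
    rw [key, e1] at this
    linear_combination (exp := 1) this
  have hQ0 : projQ w = 0 := by
    have := congrArg ((2 * Complex.I)⁻¹ • ·) h2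
    simpa [smul_smul, inv_mul_cancel₀ (by simp : (2 * Complex.I) ≠ 0)] using this
  rw [← hdec, hQ0, zero_add]
  exact projP_mem w

include hanti in
/-- **Part B of `End_ℚ(X) = ℚ(i)`.** A real-linear map of `Γ_ℝ` with RATIONAL matrix which
anticommutes with `A = I` and commutes with the complex structure `I_t` is zero (via (T4) applied to
`M''`). [cite: Voisin2002KaehlerCounterexample, §3 Prop. 3 (ii)] -/
theorem eq_zero_of_anticommute (hrat : ∀ j : Fin 8, ∃ q : Fin 8 → ℚ, L (Pi.single j 1) = ratVec q)
    (hcs : ∀ x, L (cs x) = cs (L x)) : L = 0 := by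
  choose qv hqv using hrat
  set A : Fin 4 → Fin 4 → ℚ := fun p q ↦ qv (![0, 2, 4, 6] q) (![0, 2, 4, 6] p) with hA
  set B : Fin 4 → Fin 4 → ℚ := fun p q ↦ qv (![0, 2, 4, 6] q) (![1, 3, 5, 7] p) with hB
  have hM : ∀ q, antiMap L hanti (Pi.single q 1) = gaussCol A B q := fun q ↦ by
    rw [antiMap_apply, zetaEquiv_symm_star_single, hqv]
    funext p
    fin_cases q <;> fin_cases p <;> apply Complex.ext <;>
      simp [zetaVec, gaussCol, gaussVec, hA, hB]
  have h0 : antiMap L hanti = 0 :=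
    eq_zero_of_map_NQ_le_NP _ A B hM (antiMap_mem_NP L hanti hcs h₁_mem)
      (antiMap_mem_NP L hanti hcs h₂_mem)
  apply LinearMap.ext fun x ↦ ?_
  apply zetaEquiv.injective
  change zetaVec (L x) = zetaVec ((0 : (Fin 8 → ℝ) →ₗ[ℝ] (Fin 8 → ℝ)) x)
  rw [zetaVec_L L hanti, h0, LinearMap.zero_apply, LinearMap.zero_apply]
  exact (map_zero zetaEquiv).symm

end AntiLinear

end Weil

end Literature.Geometry.Kaehler

end
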